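import Mathlib
import Summits.ValiantsHypothesis.ValiantsHypothesis.Theses.FreeFermionCLL

/-!
# Route FreeFermionCLL — support item `ExpImpliesGap` (stmt-ValiantsHypothesis-13560)

`ExpRankLaw → PMCorrelationGap`: the exchange-rate law
`‖permMass(P^(n))‖² ≤ C·(R + n + 1)^C·θⁿ·(n!·coeffNormSq(P^(n)))` (`0 < θ < 1`) gives, for total rank
`R ≤ 2^((log₂ n + c)^c)`, the gap `2·‖permMass(P^(n))‖² ≤ n!·coeffNormSq(P^(n))` for all large `n`,
because the prefactor `2·C·(2^((log₂ n + c)^c) + n + 1)^C·θⁿ` tends to `0`: after taking logarithms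
it is `n·((C·log 2)·(log₂ n + c)^c/n + C·log(n + 2)/n + log θ) + log(2C)` and
`(log₂ n + c)^c = O((log n)^c) = o(n)`, `log(n + 2) = o(n)`, `log θ < 0` (exponential decay beats
quasi-polynomial growth; elementary real analysis, `Real.tendsto_pow_log_div_mul_add_atTop`,
`Real.natLog_le_logb`).  The polynomial `P` enters only through the two real numbers
`‖permMass(P^(n))‖²` and `n!·coeffNormSq(P^(n)) ≥ 0` (`coeffNormSq_nonneg`), see
`two_mul_le_of_rankLaw`.

No new definitions; no named facts; unconditional.
-/

-- `Summit.ValiantsHypothesis.ValiantsHypothesis.…` is the tree's mandated single-conjunct layout (Sub = Summit).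
set_option linter.dupNamespace false

namespace Summit.ValiantsHypothesis.ValiantsHypothesis.Theorems.FreeFermionCLL

open Filter Topology
open Literature.Computability.AlgebraicComplexity

/-- `(Nat.log 2 n + c)^c / n → 0`: the exponent of a quasi-polynomial bound is `o(n)`
(from `(Nat.log 2 n + c)^c ≤ ((1 + c)/log 2)^c · (log n)^c` for `n ≥ 2` and `(log x)^c / x → 0`).
[folklore] -/
theorem tendsto_natLog_add_pow_div_atTop (c : ℕ) :
    Tendsto (fun n : ℕ => (((Nat.log 2 n + c) ^ c : ℕ) : ℝ) / (n : ℝ)) atTop (𝓝 0) := by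
  have hlog2 : 0 < Real.log 2 := Real.log_pos one_lt_two
  set K : ℝ := ((1 + c) / Real.log 2) ^ c with hK
  have h1 : Tendsto (fun n : ℕ => K * (Real.log n ^ c / (n : ℝ))) atTop (𝓝 0) := by
    have h := (Real.tendsto_pow_log_div_mul_add_atTop 1 0 c one_ne_zero).comp
      tendsto_natCast_atTop_atTop
    have h' : Tendsto (fun n : ℕ => Real.log n ^ c / (n : ℝ)) atTop (𝓝 0) :=
      h.congr fun n => by simp [Function.comp]
    simpa using h'.const_mul K
  refine tendsto_of_tendsto_of_tendsto_of_le_of_le' tendsto_const_nhds h1 ?_ ?_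
  · filter_upwards with n
    positivity
  · filter_upwards [eventually_ge_atTop 2] with n hn
    have hn0 : (0 : ℝ) < n := by exact_mod_cast (by omega : 0 < n)
    rw [mul_div_assoc']
    gcongr
    have hn' : (2 : ℝ) ≤ n := by exact_mod_cast hn
    have hlogn : Real.log 2 ≤ Real.log n := Real.log_le_log two_pos hn'
    have hx : (Nat.log 2 n : ℝ) ≤ Real.log n / Real.log 2 := by
      have := Real.natLog_le_logb n 2
      simpa [Real.logb] using this
    have hq : (1 : ℝ) ≤ Real.log n / Real.log 2 := by
      rwa [le_div_iff₀ hlog2, one_mul]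
    have hc : (c : ℝ) ≤ c * (Real.log n / Real.log 2) := by
      nlinarith [hq, (c.cast_nonneg : (0 : ℝ) ≤ c)]
    have hsum : ((Nat.log 2 n : ℝ) + c) ≤ (1 + c) / Real.log 2 * Real.log n := by
      have : (1 + c) / Real.log 2 * Real.log n
          = Real.log n / Real.log 2 + c * (Real.log n / Real.log 2) := by ring
      rw [this]
      exact add_le_add hx hc
    have h0 : (0 : ℝ) ≤ (Nat.log 2 n : ℝ) + c := by positivity
    calc (((Nat.log 2 n + c) ^ c : ℕ) : ℝ) = ((Nat.log 2 n : ℝ) + c) ^ c := by push_cast; ring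
      _ ≤ ((1 + c) / Real.log 2 * Real.log n) ^ c := pow_le_pow_left₀ h0 hsum c
      _ = K * Real.log n ^ c := by rw [hK, mul_pow]

/-- `log (n + 2) / n → 0`. [folklore] -/
theorem tendsto_log_add_two_div_atTop :
    Tendsto (fun n : ℕ => Real.log ((n : ℝ) + 2) / (n : ℝ)) atTop (𝓝 0) := by
  have h := (Real.tendsto_pow_log_div_mul_add_atTop 1 (-2) 1 one_ne_zero).comp
    (tendsto_atTop_add_const_right atTop (2 : ℝ) tendsto_natCast_atTop_atTop)
  refine h.congr fun n => ?_
  simp only [Function.comp_apply, pow_one, one_mul]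
  rw [show ((n : ℝ) + 2 + -2) = n by ring]

/-- **Exponential decay beats quasi-polynomial growth**: for `0 < θ < 1` and all `C c : ℕ`,
`2·C·(2^((Nat.log 2 n + c)^c) + n + 1)^C·θⁿ ≤ 1` for all sufficiently large `n`. [folklore] -/
theorem eventually_quasipoly_mul_geom_le_one (C c : ℕ) {θ : ℝ} (hθ0 : 0 < θ) (hθ1 : θ < 1) :
    ∃ n₀ : ℕ, ∀ n ≥ n₀,
      2 * (C : ℝ) * ((2 : ℝ) ^ ((Nat.log 2 n + c) ^ c) + n + 1) ^ C * θ ^ n ≤ 1 := by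
  set a : ℕ → ℕ := fun n => (Nat.log 2 n + c) ^ c with ha
  set E : ℕ → ℝ := fun n =>
    (C : ℝ) * (a n : ℝ) * Real.log 2 + C * Real.log ((n : ℝ) + 2) + n * Real.log θ with hE
  have hθlog : Real.log θ < 0 := Real.log_neg hθ0 hθ1
  -- the bracket tends to `log θ < 0`
  have hinner : Tendsto (fun n : ℕ => (C : ℝ) * Real.log 2 * ((a n : ℝ) / n)
      + C * (Real.log ((n : ℝ) + 2) / n) + Real.log θ) atTop (𝓝 (Real.log θ)) := by
    have h1 := (tendsto_natLog_add_pow_div_atTop c).const_mul ((C : ℝ) * Real.log 2)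
    have h2 := tendsto_log_add_two_div_atTop.const_mul (C : ℝ)
    have h3 := (h1.add h2).add_const (Real.log θ)
    simpa [ha] using h3
  -- hence the exponent tends to `-∞`
  have hE' : Tendsto E atTop atBot := by
    have h := tendsto_natCast_atTop_atTop.atTop_mul_neg hθlog hinner
    refine h.congr' ?_
    filter_upwards [eventually_ge_atTop 1] with n hn
    have hn0 : (n : ℝ) ≠ 0 := by exact_mod_cast (by omega : n ≠ 0)
    simp only [hE]
    field_simp
  have hg : Tendsto (fun n => 2 * (C : ℝ) * Real.exp (E n)) atTop (𝓝 0) := by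
    simpa using (Real.tendsto_exp_atBot.comp hE').const_mul (2 * (C : ℝ))
  obtain ⟨n₀, hn₀⟩ := eventually_atTop.1 (hg.eventually_lt_const one_pos)
  refine ⟨max n₀ 1, fun n hn => ?_⟩
  have hlt := hn₀ n (le_of_max_le_left hn)
  refine le_trans ?_ hlt.le
  -- `f n ≤ 2 C exp (E n)`
  have h2a : (1 : ℝ) ≤ (2 : ℝ) ^ a n := one_le_pow₀ (by norm_num)
  have hn0 : (0 : ℝ) ≤ n := n.cast_nonneg
  have hbase : (2 : ℝ) ^ a n + n + 1 ≤ (2 : ℝ) ^ a n * ((n : ℝ) + 2) := by nlinarith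
  have e1 : Real.exp ((C : ℝ) * (a n : ℝ) * Real.log 2) = ((2 : ℝ) ^ a n) ^ C := by
    rw [← pow_mul, ← Real.exp_log (pow_pos two_pos (a n * C)), Real.log_pow]
    push_cast
    ring_nf
  have e2 : Real.exp ((C : ℝ) * Real.log ((n : ℝ) + 2)) = ((n : ℝ) + 2) ^ C := by
    rw [Real.exp_nat_mul, Real.exp_log (by positivity)]
  have e3 : Real.exp ((n : ℝ) * Real.log θ) = θ ^ n := by
    rw [Real.exp_nat_mul, Real.exp_log hθ0]
  have hexp : Real.exp (E n) = ((2 : ℝ) ^ a n) ^ C * ((n : ℝ) + 2) ^ C * θ ^ n := by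
    simp only [hE, Real.exp_add, e1, e2, e3]
  calc 2 * (C : ℝ) * ((2 : ℝ) ^ a n + n + 1) ^ C * θ ^ n
      ≤ 2 * (C : ℝ) * ((2 : ℝ) ^ a n * ((n : ℝ) + 2)) ^ C * θ ^ n := by gcongr
    _ = 2 * (C : ℝ) * Real.exp (E n) := by rw [hexp, mul_pow]; ring

/-- Bookkeeping step: from the rank law `m ≤ C·(R + n + 1)^C·θⁿ·N`, a rank bound `R ≤ 2^a`, the
eventual estimate `2·C·(2^a + n + 1)^C·θⁿ ≤ 1` and `0 ≤ N`, conclude `2·m ≤ N`. [folklore] -/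
theorem two_mul_le_of_rankLaw {m N θ : ℝ} {C R n a : ℕ} (hθ : 0 ≤ θ)
    (hm : m ≤ (C : ℝ) * ((R : ℝ) + n + 1) ^ C * θ ^ n * N) (hR : R ≤ 2 ^ a)
    (hkey : 2 * (C : ℝ) * ((2 : ℝ) ^ a + n + 1) ^ C * θ ^ n ≤ 1) (hN : 0 ≤ N) : 2 * m ≤ N := by
  have hR' : (R : ℝ) ≤ (2 : ℝ) ^ a := by exact_mod_cast hR
  have hθn : 0 ≤ θ ^ n := pow_nonneg hθ n
  calc 2 * m ≤ 2 * ((C : ℝ) * ((R : ℝ) + n + 1) ^ C * θ ^ n * N) := by linarith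
    _ = (2 * (C : ℝ) * ((R : ℝ) + n + 1) ^ C * θ ^ n) * N := by ring
    _ ≤ (2 * (C : ℝ) * ((2 : ℝ) ^ a + n + 1) ^ C * θ ^ n) * N := by gcongr
    _ ≤ 1 * N := by gcongr
    _ = N := one_mul N

/-- **Item `ExpImpliesGap` (stmt-ValiantsHypothesis-13560)**: the exchange-rate law `ExpRankLaw`
(`corr² ≤ C·(R + n + 1)^C·θⁿ`, `0 < θ < 1`) implies the target gap `PMCorrelationGap`
(`corr² ≤ 1/2` for total rank `R ≤ 2^((log₂ n + c)^c)`, eventually in `n`), because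
`C·(2^((log₂ n + c)^c) + n + 1)^C·θⁿ → 0`. [folklore] -/
theorem expImpliesGap_proof :
    Summit.ValiantsHypothesis.ValiantsHypothesis.Theses.FreeFermionCLL.ExpImpliesGap := by
  unfold Theses.FreeFermionCLL.ExpImpliesGap Theses.FreeFermionCLL.ExpRankLaw
    Theses.FreeFermionCLL.PMCorrelationGap
  rintro ⟨C, θ, hθ0, hθ1, hlaw⟩ c
  obtain ⟨n₀, hn₀⟩ := eventually_quasipoly_mul_geom_le_one C c hθ0 hθ1
  refine ⟨n₀, fun n hn R hR K κ => ?_⟩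
  exact two_mul_le_of_rankLaw hθ0.le (hlaw n R K κ) hR (hn₀ n hn)
    (mul_nonneg (Nat.cast_nonneg _) (coeffNormSq_nonneg _))

end Summit.ValiantsHypothesis.ValiantsHypothesis.Theorems.FreeFermionCLL
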